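import Mathlib.Analysis.SpecialFunctions.Pow.Real
import Mathlib.Analysis.SpecialFunctions.Log.Base
import Mathlib.Analysis.Complex.ExponentialBounds
import Mathlib.Algebra.BigOperators.Ring.Finset
import Mathlib.Data.Finset.Powerset
import Mathlib.Data.Nat.Choose.Sum
import Literature.Computability.AlgebraicComplexity.MatrixMultiplicationExponent
import HarnessLib
import HarnessLib.Audit

/-!
# Barrier: the Coppersmith–Winograd "no three disjoint equivoluminous subsets" route to `ω = 2` is closed by the sunflower / cap-set bounds (Coppersmith–Winograd 1990 §11; Alon–Shpilka–Umans 2013; Naslund–Sawin 2017)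

Topic `Literature/Barriers/MatrixMultiplication` (D-0021 barrier catalogue for the summit
`MatrixMultiplication`, `ω(ℂ) = 2`; the Coppersmith–Winograd / laser-method line, its proposed
combinatorial continuation to `ω = 2`).

Sources.
* D. Coppersmith, S. Winograd, *Matrix multiplication via arithmetic progressions*, J. Symbolic
  Comput. 9 (1990) 251–280, §11 "Can we achieve `ω = 2`?" (held copy
  `paper:doi-10-1016-s0747-7171-08-80013-2`, pp. 277–279 of the journal = pp. 27–29 of the held
  scan, read with `lit read`: the Definition, the hypothesis "(log₂|G|)/|S| approaches 0", the
  derivation sketch, and "We have not been able to determine whether there exist such pairs").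
  [CoppersmithWinograd1990]
* E. Naslund, W. F. Sawin, *Upper bounds for sunflower-free sets*, Forum Math. Sigma 5 (2017) e15,
  arXiv:1606.09575 (held; numbering checked on the arXiv PDF: Conjecture 1, Conjecture 2
  (Erdős–Szemerédi), Theorem 3, Conjecture 4, Theorem 5). [NaslundSawin2017]
* N. Alon, A. Shpilka, C. Umans, *On sunflowers and matrix multiplication*, Comput. Complexity 22
  (2013) 219–243 — the link "sunflower conjectures ⇒ negative answer to the CW question"; NOT held
  in the store (acquisition request acq-00344), cited here only through the sentence of
  Blasiak–Church–Cohn–Grochow–Naslund–Sawin–Umans 2017, §1 (p. 2): "Via the connections established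
  earlier by Alon, Shpilka, and Umans [ASU], the cap set bounds prove the Erdős–Szemerédi sunflower
  conjecture [ES] and disprove the Coppersmith–Winograd 'no three disjoint equivoluminous subsets'
  conjecture [CW], which was proposed as a means to show that the exponent `ω` of matrix
  multiplication is `2`." [BlasiakChurchCohnGrochowNaslundSawinUmans2017] The elementary reduction
  used below (sum-fibres of the power set are sunflower-free) is PROVED in this file, so no
  statement of ASU is vendored.

## Catalogue entry

The D-0021 structured block is in the docstring of the catalogue declaration
`EquivoluminousBarrier` at the end of this file.

## Content

* `IsSunflowerFree 𝓕` (3-sunflower-free family of finite sets), `NoThreeDisjointEquivoluminous S`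
  (CW 1990 §11), `sumFibre S g`.
* PROVED: `NoThreeDisjointEquivoluminous.isSunflowerFree_sumFibre` (each family of subsets of `S`
  with a fixed sum is sunflower-free), `.two_pow_card_le` (`2^{|S|} ≤ |G| · M` for any bound `M` on
  sunflower-free families of subsets of `S`), the binomial tail bound `sum_choose_mul_pow_le` /
  `sum_choose_third_le`.
* Named facts: `NaslundSawin2017_thm3` (the sunflower bound), `CoppersmithWinograd1990_sec11`
  (CW's derivation: hypothesis ⇒ `ω = 2`) — both DISCHARGED in the companion file
  `EquivoluminousBarrierProofs.lean` (`NaslundSawin2017_thm3_holds` by the slice-rank method,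
  `CoppersmithWinograd1990_sec11_holds` vacuously) — and the retired, `@[deprecated]` record
  `CWEquivoluminousHypothesis` of CW's working hypothesis (see "Verdict clean-up" below).
* PROVED from `NaslundSawin2017_thm3`: `.two_pow_le_card_mul`, `.two_pow_le_real`, `.log_card_ge`
  (`log|G| ≥ |S|/20 − log 3 − log(|S|+1)`) and **`not_cwEquivoluminousHypothesis`** — the pairs
  `(G,S)` CW asked for do not exist.
* Catalogue entry `EquivoluminousBarrier : Prop := NaslundSawin2017_thm3 ∧ CoppersmithWinograd1990_sec11`
  with the D-0021 block; `EquivoluminousBarrier.hypothesis_false`. (`EquivoluminousBarrier_holds`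
  and the unconditional `not_cwEquivoluminousHypothesis_unconditional` are in the companion file.)

## Verdict clean-up (2026-08-16): `CWEquivoluminousHypothesis` is RETIRED FROM LITERATURE DEBT as refuted

`CWEquivoluminousHypothesis` is not a literature fact and can never be discharged. Coppersmith and
Winograd POSE it as a working hypothesis ("Assume for now that we can find a sequence of pairs
`G, S` …", p. 277 of the journal = p. 27 of the held scan) and close §11 with "We have not been
able to determine whether there exist such pairs `(G,S)` with `(log₂|G|)/|S|` approaching `0`"
(p. 279 = p. 29); nothing about it is proved there, and it is FALSE. Its refutations are
kernel-checked theorems of the tree (axioms `propext`, `Classical.choice`, `Quot.sound` only):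

* `Literature.Barriers.MatrixMultiplication.not_cwEquivoluminousHypothesis :
  NaslundSawin2017_thm3 → ¬ CWEquivoluminousHypothesis` (this file; every pair has
  `log₂|G| ≥ |S|/80000`), and
* `Literature.Barriers.MatrixMultiplication.not_cwEquivoluminousHypothesis_unconditional :
  ¬ CWEquivoluminousHypothesis` (`EquivoluminousBarrierProofs.lean`, where
  `NaslundSawin2017_thm3_holds` is proved; rate form
  `NoThreeDisjointEquivoluminous.logb_card_ge_rate`: `log₂|G| ≥ 0.0817·|S| − log₂(3(|S|+1))`).

Following the tenured prove-seat's verdict (refuted; counted as a fact only for being a cite-tagged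
closed `Prop`), re-checked against the
held scan, the `def` is kept **statement byte-for-byte** but carries `@[deprecated]` with a pointer
to the refuting theorems: it cannot be deleted while `CoppersmithWinograd1990_sec11` (whose
antecedent it is), `not_cwEquivoluminousHypothesis`, `EquivoluminousBarrier.hypothesis_false`
(each silences `linter.deprecated` for itself only, with a REMOVE-WHEN note) and the companion
file's `not_cwEquivoluminousHypothesis_unconditional` name it. Its former `@[conjecture]` tag is
dropped: the proposition is settled (its negation is a theorem), not open. There is NO corrected
statement to vendor under a new name: the true statement is the negation, i.e. the linear lower
bound `log₂|G| ≥ c·|S|` for every pair, which the theorems above already are.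

## Design choices and wording risks

* CW's hypothesis "a sequence of pairs with `(log₂|G|)/|S| → 0`" is formalised as: for every
  `ε > 0` some pair has `log₂|G| < ε|S|` (with `|G| ≥ 2`, part of CW's definition); the two are
  equivalent (pick `ε = 1/k`).
* CW present §11 as a sketch ("we sketch the relation …"); `CoppersmithWinograd1990_sec11` records
  the implication they derive, as a named fact, not as a theorem of the tree.
* The refutation needs only an exponential saving for sunflower-free families of subsets of an
  `n`-set (Erdős–Szemerédi-type); we use Naslund–Sawin's explicit Thm. 3. The proved constant
  `1/80000` in `not_cwEquivoluminousHypothesis` is deliberately crude (no numerics beyond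
  `log 2 ≈ 0.693`); the block records the true rate `log₂((2/3)2^{2/3}) = 0.0817…`.
* The strong USP conjecture of CKSU 2005 (also refuted, via the tricolored bound — BCCGNSU Thm. A)
  is not formalised here (its definition is in ASU / CKSU §3, not held); see
  `TricoloredSumFreeBarrier.lean`.
-/

noncomputable section

open scoped BigOperators
open Finset

namespace Literature.Barriers.MatrixMultiplication

universe u

/-! ## Sunflower-free families and the CW property -/

section Defs

variable {α : Type u} [DecidableEq α]

/-- A family `𝓕` of finite sets is **(3-)sunflower-free** (Naslund–Sawin 2017, §1: "A collection of
`k` sets is said to form a `k`-sunflower, or `Δ`-system, if the intersection of any two sets from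
the collection is the same … when `k = 3` we simply say that the collection `𝓕` is
sunflower-free"): no three distinct members `A, B, C ∈ 𝓕` have `A ∩ B = A ∩ C = B ∩ C`.
[cite: NaslundSawin2017, §1] -/
def IsSunflowerFree (𝓕 : Finset (Finset α)) : Prop :=
  ∀ A ∈ 𝓕, ∀ B ∈ 𝓕, ∀ C ∈ 𝓕, A ≠ B → B ≠ C → A ≠ C → ¬ (A ∩ B = A ∩ C ∧ A ∩ B = B ∩ C)

/-- Sub-families of a sunflower-free family are sunflower-free. [folklore] -/
theorem IsSunflowerFree.subset {𝓕 𝓖 : Finset (Finset α)} (h : IsSunflowerFree 𝓕) (hsub : 𝓖 ⊆ 𝓕) :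
    IsSunflowerFree 𝓖 :=
  fun A hA B hB C hC => h A (hsub hA) B (hsub hB) C (hsub hC)

variable {G : Type u} [AddCommGroup G] [DecidableEq G]

/-- The **"no three disjoint equivoluminous subsets" property** of Coppersmith–Winograd 1990, §11
("An Abelian group `G` (with at least two elements) and a subset `S` of `G` satisfy the no three
disjoint equivoluminous subsets property if: whenever `T₁, T₂, T₃` are three disjoint subsets of
`S`, not all empty, they cannot all have the same sum in `G`"). The size condition on `G` is kept
as a separate hypothesis where needed. [cite: CoppersmithWinograd1990, §11 (Definition)] -/
def NoThreeDisjointEquivoluminous (S : Finset G) : Prop :=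
  ∀ T₁ T₂ T₃ : Finset G, T₁ ⊆ S → T₂ ⊆ S → T₃ ⊆ S →
    Disjoint T₁ T₂ → Disjoint T₂ T₃ → Disjoint T₁ T₃ → ¬ (T₁ = ∅ ∧ T₂ = ∅ ∧ T₃ = ∅) →
      ¬ (∑ s ∈ T₁, s = ∑ s ∈ T₂, s ∧ ∑ s ∈ T₂, s = ∑ s ∈ T₃, s)

end Defs

/-! ## The reduction: each sum-fibre of the power set is sunflower-free (after Alon–Shpilka–Umans) -/

section Reduction

variable {G : Type u} [AddCommGroup G] [DecidableEq G]

/-- The sub-family of subsets of `S` with sum `g`. [folklore] -/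
def sumFibre (S : Finset G) (g : G) : Finset (Finset G) :=
  S.powerset.filter fun T => ∑ s ∈ T, s = g

omit [DecidableEq G] in
/-- Core computation: for a sunflower `A ∩ B = A ∩ C = B ∩ C = Y`, the petals `A ∖ Y` are pairwise
disjoint and `∑ (A ∖ Y) = ∑ A − ∑ Y`. [folklore] -/
theorem sum_sdiff_eq_sub [DecidableEq G] (A Y : Finset G) (hY : Y ⊆ A) :
    ∑ s ∈ A \ Y, s = ∑ s ∈ A, s - ∑ s ∈ Y, s := by
  rw [eq_sub_iff_add_eq, Finset.sum_sdiff hY]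

/-- **The CW property makes every sum-fibre sunflower-free** (the link between Coppersmith–Winograd's
§11 property and sunflowers, due to Alon–Shpilka–Umans 2013; cf. BCCGNSU 2017, §1: "Via the
connections established earlier by Alon, Shpilka, and Umans, the cap set bounds … disprove the
Coppersmith–Winograd 'no three disjoint equivoluminous subsets' conjecture"): if three distinct
subsets of `S` with the same sum formed a sunflower with kernel `Y`, the petals `A ∖ Y, B ∖ Y, C ∖ Y`
would be disjoint, not all empty, and equivoluminous. PROVED.
[cite: BlasiakChurchCohnGrochowNaslundSawinUmans2017, §1 (p. 2)] -/
theorem NoThreeDisjointEquivoluminous.isSunflowerFree_sumFibre {S : Finset G}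
    (h : NoThreeDisjointEquivoluminous S) (g : G) : IsSunflowerFree (sumFibre S g) := by
  intro A hA B hB C hC hAB hBC hAC ⟨h1, h2⟩
  simp only [sumFibre, Finset.mem_filter, Finset.mem_powerset] at hA hB hC
  set Y := A ∩ B with hYdef
  have hYA : Y ⊆ A := Finset.inter_subset_left
  have hYB : Y ⊆ B := Finset.inter_subset_right
  have hYC : Y ⊆ C := h1.symm ▸ (Finset.inter_subset_right : A ∩ C ⊆ C)
  -- the petals
  refine h (A \ Y) (B \ Y) (C \ Y) (sdiff_subset.trans hA.1) (sdiff_subset.trans hB.1)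
    (sdiff_subset.trans hC.1) ?_ ?_ ?_ ?_ ⟨?_, ?_⟩
  · -- `A ∖ Y` and `B ∖ Y` are disjoint since `A ∩ B = Y`
    rw [Finset.disjoint_left]
    intro x hxA hxB
    rw [Finset.mem_sdiff] at hxA hxB
    exact hxA.2 (Finset.mem_inter.2 ⟨hxA.1, hxB.1⟩)
  · rw [Finset.disjoint_left]
    intro x hxB hxC
    rw [Finset.mem_sdiff] at hxB hxC
    have : x ∈ B ∩ C := Finset.mem_inter.2 ⟨hxB.1, hxC.1⟩
    rw [← h2] at this
    exact hxB.2 this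
  · rw [Finset.disjoint_left]
    intro x hxA hxC
    rw [Finset.mem_sdiff] at hxA hxC
    have : x ∈ A ∩ C := Finset.mem_inter.2 ⟨hxA.1, hxC.1⟩
    rw [← h1] at this
    exact hxA.2 this
  · -- not all petals empty: otherwise `A = B = C = Y`
    rintro ⟨hA0, hB0, -⟩
    apply hAB
    rw [Finset.sdiff_eq_empty_iff_subset] at hA0 hB0
    exact (Finset.Subset.antisymm hA0 hYA).trans (Finset.Subset.antisymm hB0 hYB).symm
  · rw [sum_sdiff_eq_sub A Y hYA, sum_sdiff_eq_sub B Y hYB, hA.2, hB.2]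
  · rw [sum_sdiff_eq_sub B Y hYB, sum_sdiff_eq_sub C Y hYC, hB.2, hC.2]

/-- **Counting**: if every sunflower-free family of subsets of `S` has at most `M` members and `S`
has the CW property in a finite abelian group `G`, then `2^{|S|} ≤ |G| · M` (the `2^{|S|}` subsets
of `S` fall into `|G|` sum-fibres, each sunflower-free). PROVED.
[cite: BlasiakChurchCohnGrochowNaslundSawinUmans2017, §1 (p. 2)] -/
theorem NoThreeDisjointEquivoluminous.two_pow_card_le [Fintype G] {S : Finset G}
    (h : NoThreeDisjointEquivoluminous S) {M : ℕ}
    (hM : ∀ 𝓕 : Finset (Finset G), (∀ A ∈ 𝓕, A ⊆ S) → IsSunflowerFree 𝓕 → 𝓕.card ≤ M) :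
    2 ^ S.card ≤ Fintype.card G * M := by
  classical
  calc 2 ^ S.card = S.powerset.card := (Finset.card_powerset S).symm
    _ = ∑ g : G, (sumFibre S g).card :=
        Finset.card_eq_sum_card_fiberwise (f := fun T : Finset G => ∑ s ∈ T, s)
          (fun T _ => Finset.mem_univ _)
    _ ≤ ∑ _g : G, M := Finset.sum_le_sum fun g _ => hM _
          (fun A hA => (Finset.mem_powerset.1 (Finset.mem_filter.1 hA).1))
          (h.isSunflowerFree_sumFibre g)
    _ = Fintype.card G * M := by rw [Finset.sum_const, Finset.card_univ, smul_eq_mul]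

end Reduction

/-! ## Naslund–Sawin 2017, Thm. 3 (statement) and a binomial tail bound (proved) -/

section NaslundSawin

/-- **Naslund–Sawin 2017, Theorem 3** ("Let `𝓕` be a sunflower-free collection of subsets of
`{1,2,…,n}`. Then `|𝓕| ≤ 3(n+1) ∑_{k ≤ n/3} binom(n,k)`, and `μ₃^S ≤ 3/2^{2/3} = 1.889881574…`";
the Erdős–Szemerédi sunflower conjecture for `k = 3`, first derived from the cap-set theorem via
Alon–Shpilka–Umans), stated for families of subsets of an arbitrary `n`-element finite set `X`
(relabel `X ≅ {1,…,n}`); `∑_{k ≤ n/3}` is the sum over `0 ≤ k ≤ ⌊n/3⌋`.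
[cite: NaslundSawin2017, Thm. 3] -/
def NaslundSawin2017_thm3 : Prop :=
  ∀ (α : Type) [DecidableEq α] (X : Finset α) (𝓕 : Finset (Finset α)), (∀ A ∈ 𝓕, A ⊆ X) →
    IsSunflowerFree 𝓕 →
      𝓕.card ≤ 3 * (X.card + 1) * ∑ k ∈ Finset.range (X.card / 3 + 1), X.card.choose k

/-- Binomial tail bound: for `0 < x ≤ 1` and `m ≤ n`,
`(∑_{k ≤ m} binom(n,k)) · x^m ≤ (1 + x)^n` (each `binom(n,k) x^m ≤ binom(n,k) x^k`, then the binomial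
theorem). [folklore] -/
theorem sum_choose_mul_pow_le (n m : ℕ) (hm : m ≤ n) {x : ℝ} (hx0 : 0 ≤ x) (hx1 : x ≤ 1) :
    (∑ k ∈ Finset.range (m + 1), (n.choose k : ℝ)) * x ^ m ≤ (1 + x) ^ n := by
  rw [Finset.sum_mul]
  calc ∑ k ∈ Finset.range (m + 1), (n.choose k : ℝ) * x ^ m
      ≤ ∑ k ∈ Finset.range (m + 1), (n.choose k : ℝ) * x ^ k := by
        refine Finset.sum_le_sum fun k hk => ?_
        have hkm : k ≤ m := Nat.lt_succ_iff.1 (Finset.mem_range.1 hk)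
        exact mul_le_mul_of_nonneg_left (pow_le_pow_of_le_one hx0 hx1 hkm) (Nat.cast_nonneg _)
    _ ≤ ∑ k ∈ Finset.range (n + 1), (n.choose k : ℝ) * x ^ k := by
        refine Finset.sum_le_sum_of_subset_of_nonneg
          (Finset.range_subset_range.2 (Nat.succ_le_succ hm)) ?_
        intro k _ _
        positivity
    _ = (1 + x) ^ n := by
        conv_rhs => rw [add_comm, add_pow]
        refine Finset.sum_congr rfl fun k _ => ?_
        rw [one_pow, mul_one, mul_comm]

/-- In particular `∑_{k ≤ ⌊n/3⌋} binom(n,k) ≤ 2^{⌊n/3⌋} (3/2)^n` (`x = 1/2`). [folklore] -/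
theorem sum_choose_third_le (n : ℕ) :
    (∑ k ∈ Finset.range (n / 3 + 1), (n.choose k : ℝ)) ≤ 2 ^ (n / 3) * (3 / 2 : ℝ) ^ n := by
  have h := sum_choose_mul_pow_le n (n / 3) (Nat.div_le_self n 3) (x := 1 / 2) (by norm_num)
    (by norm_num)
  have h2 : (0 : ℝ) < (1 / 2 : ℝ) ^ (n / 3) := by positivity
  rw [← le_div_iff₀ h2] at h
  refine h.trans (le_of_eq ?_)
  rw [show (1 : ℝ) + 1 / 2 = 3 / 2 by norm_num, one_div, inv_pow, div_inv_eq_mul, mul_comm]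

end NaslundSawin

/-! ## The barrier inequality (proved from Naslund–Sawin) and the CW hypothesis -/

section Barrier

variable {G : Type} [AddCommGroup G] [DecidableEq G] [Fintype G]

/-- **`2^{|S|} ≤ |G| · 3(|S|+1) ∑_{k ≤ |S|/3} binom(|S|,k)`** for every `S` with the CW property in a
finite abelian group, given Naslund–Sawin's Thm. 3 (PROVED from the fact and the reduction).
[cite: NaslundSawin2017, Thm. 3] -/
theorem NoThreeDisjointEquivoluminous.two_pow_le_card_mul (hNS : NaslundSawin2017_thm3)
    {S : Finset G} (h : NoThreeDisjointEquivoluminous S) :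
    2 ^ S.card ≤ Fintype.card G *
      (3 * (S.card + 1) * ∑ k ∈ Finset.range (S.card / 3 + 1), S.card.choose k) :=
  h.two_pow_card_le fun 𝓕 h𝓕 hsf => hNS G S 𝓕 h𝓕 hsf

/-- Real form with the binomial tail estimated: `|G| ≥ ((2/3)·2^{2/3})ⁿ⁄(3(n+1))`-type bound,
precisely `2ⁿ ≤ |G| · 3(n+1) · 2^{⌊n/3⌋} (3/2)ⁿ` with `n = |S|`; so
`log₂|G| ≥ n log₂(2^{2/3}·(2/3)) − log₂(3(n+1))`, and `log₂|G|/|S|` stays `≥ 0.0817 − o(1)`.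
[cite: NaslundSawin2017, Thm. 3] -/
theorem NoThreeDisjointEquivoluminous.two_pow_le_real (hNS : NaslundSawin2017_thm3)
    {S : Finset G} (h : NoThreeDisjointEquivoluminous S) :
    (2 : ℝ) ^ S.card ≤
      Fintype.card G * (3 * (S.card + 1) * (2 ^ (S.card / 3) * (3 / 2 : ℝ) ^ S.card)) := by
  have h1 := h.two_pow_le_card_mul hNS
  have h1' : ((2 ^ S.card : ℕ) : ℝ) ≤ ((Fintype.card G *
      (3 * (S.card + 1) * ∑ k ∈ Finset.range (S.card / 3 + 1), S.card.choose k) : ℕ) : ℝ) := by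
    exact_mod_cast h1
  push_cast at h1'
  refine h1'.trans ?_
  gcongr
  exact sum_choose_third_le S.card

/-- **RETIRED — refuted (verdict clean-up 2026-08-16); not literature debt: no
`CWEquivoluminousHypothesis_holds` can exist, its negation is a theorem of the tree.** The record,
statement byte-for-byte: the WORKING HYPOTHESIS of Coppersmith–Winograd 1990, §11 — "Assume for now
that we can find a sequence of pairs `G, S` with the no three disjoint equivoluminous subsets
property, such that `(log₂|G|)/|S|` approaches `0`" (p. 277), closed by "We have not been able to
determine whether there exist such pairs `(G,S)`" (p. 279) — i.e. for every `ε > 0` some pair (with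
`|G| ≥ 2`, as in CW's Definition) has `log₂|G| < ε|S|`. CW assume it and prove nothing about it:
it is not a published result (it entered the facts census only as a cite-tagged closed `Prop`),
and it is FALSE — **refuted in the tree** by `not_cwEquivoluminousHypothesis` below (from the
sunflower bound `NaslundSawin2017_thm3`: every pair has `log₂|G| ≥ |S|/80000`) and,
unconditionally, by
`Literature.Barriers.MatrixMultiplication.not_cwEquivoluminousHypothesis_unconditional`
(`EquivoluminousBarrierProofs.lean`, where `NaslundSawin2017_thm3_holds` is proved by the
slice-rank method; rate `NoThreeDisjointEquivoluminous.logb_card_ge_rate`: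
`log₂|G| ≥ 0.0817·|S| − log₂(3(|S|+1))`) — the formal content of BCCGNSU 2017, §1 (p. 2), "the
cap set bounds … disprove" CW's §11 hypothesis. No corrected statement is vendored under a new
name: the true statement is the negation, which those theorems are. Kept as a `@[deprecated]`
record only because `CoppersmithWinograd1990_sec11` (its antecedent),
`not_cwEquivoluminousHypothesis`, `EquivoluminousBarrier.hypothesis_false` and the companion
file's refutation name it; the former `@[conjecture]` tag is dropped (settled, not open).
[cite: CoppersmithWinograd1990, §11 (pp. 277–279: the working hypothesis as posed — assumed there, not proved)] -/
@[deprecated "refuted, not a fact: see \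
  Literature.Barriers.MatrixMultiplication.not_cwEquivoluminousHypothesis (this file, from \
  NaslundSawin2017_thm3) and \
  Literature.Barriers.MatrixMultiplication.not_cwEquivoluminousHypothesis_unconditional \
  (EquivoluminousBarrierProofs.lean); CW 1990 §11 only ASSUME such pairs (G,S) exist, and by the \
  sunflower / cap-set bound (Naslund-Sawin 2017 Thm. 3, via Alon-Shpilka-Umans) they do not: \
  log2 |G| >= 0.0817 |S| - log2 (3(|S|+1)) for every pair (logb_card_ge_rate)"
  (since := "2026-08-16")]
def CWEquivoluminousHypothesis : Prop :=
  ∀ ε : ℝ, 0 < ε → ∃ (G : Type) (_ : AddCommGroup G) (_ : Fintype G) (_ : DecidableEq G)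
    (S : Finset G), 1 < Fintype.card G ∧ NoThreeDisjointEquivoluminous S ∧
      Real.logb 2 (Fintype.card G) < ε * S.card

-- names the `@[deprecated]` (refuted) record `CWEquivoluminousHypothesis` on purpose: it IS the
-- antecedent of CW's implication (verdict clean-up 2026-08-16); REMOVE-WHEN the record is deleted
set_option linter.deprecated false in
/-- **Coppersmith–Winograd 1990, §11** ("Can we achieve `ω = 2`?"): granting the hypothesis, the
`n`-th tensor powers of `x₀y₁z₂ + x₀y₂z₁ + x₁y₀z₂ + x₂y₀z₁ + x₁y₂z₀ + x₂y₁z₀` have border rank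
`≤ |G|² 3ⁿ` after the Fourier/roots-of-unity cancellation of the unwanted terms, and "following the
arguments from Chapter 6 … With the assumption that `ζ = (log₂|G|)/|S|` approaches `0`, this would
yield `ω = 2`. We have not been able to determine whether there exist such pairs `(G,S)`." The
derivation as printed (a sketch in CW's words: "we sketch the relation between a hypothetical
combinatorial construction and the elusive `ω = 2`"); `ω` is the tree's `omega ℂ`.
[cite: CoppersmithWinograd1990, §11] -/
def CoppersmithWinograd1990_sec11 : Prop :=
  CWEquivoluminousHypothesis → Literature.Computability.AlgebraicComplexity.omega ℂ = 2

/-- Numerical constant: `(2/3) log 2 − log(3/2) = (1/3) log(32/27) ≥ 1/20` (indeed `≈ 0.0566`; it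
is the natural logarithm of `(2/3)·2^{2/3}`, the constant `δ` of BCCGNSU 2017, Thm. A′). [folklore] -/
theorem one_div_twenty_le_log_const : (1 / 20 : ℝ) ≤ 2 / 3 * Real.log 2 - Real.log (3 / 2) := by
  have e1 : Real.log (32 / 27) = 2 * Real.log 2 - 3 * Real.log (3 / 2) := by
    rw [show (32 / 27 : ℝ) = 2 ^ 2 / (3 / 2) ^ 3 by norm_num,
      Real.log_div (by norm_num) (by norm_num), Real.log_pow, Real.log_pow]
    push_cast
    ring
  have key : 2 / 3 * Real.log 2 - Real.log (3 / 2) = Real.log (32 / 27) / 3 := by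
    rw [e1]; ring
  rw [key]
  have h := Real.one_sub_inv_le_log_of_pos (show (0 : ℝ) < 32 / 27 by norm_num)
  norm_num at h ⊢
  linarith

/-- Logarithmic form of the barrier inequality: `log|G| ≥ |S|/20 − log 3 − log(|S|+1)`.
[cite: NaslundSawin2017, Thm. 3] -/
theorem NoThreeDisjointEquivoluminous.log_card_ge (hNS : NaslundSawin2017_thm3)
    {S : Finset G} (h : NoThreeDisjointEquivoluminous S) (hG : 1 < Fintype.card G) :
    (S.card : ℝ) / 20 - Real.log 3 - Real.log (S.card + 1) ≤ Real.log (Fintype.card G) := by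
  set n := S.card with hn
  have hG0 : (0 : ℝ) < Fintype.card G := by exact_mod_cast (zero_lt_one.trans hG)
  have hmain : (2 : ℝ) ^ n ≤
      (Fintype.card G : ℝ) * 3 * ((n : ℝ) + 1) * 2 ^ (n / 3) * (3 / 2 : ℝ) ^ n :=
    (h.two_pow_le_real hNS).trans (le_of_eq (by ring))
  have hl := Real.log_le_log (by positivity) hmain
  rw [Real.log_pow, Real.log_mul (by positivity) (by positivity),
    Real.log_mul (by positivity) (by positivity), Real.log_mul (by positivity) (by positivity),
    Real.log_mul (by positivity) (by positivity), Real.log_pow, Real.log_pow] at hl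
  have hfloor : ((n / 3 : ℕ) : ℝ) * Real.log 2 ≤ (n : ℝ) / 3 * Real.log 2 :=
    mul_le_mul_of_nonneg_right Nat.cast_div_le (Real.log_nonneg (by norm_num))
  have hc := mul_le_mul_of_nonneg_left one_div_twenty_le_log_const (Nat.cast_nonneg n)
  nlinarith [hl, hfloor, hc]

-- names the `@[deprecated]` (refuted) record `CWEquivoluminousHypothesis` on purpose: this IS its
-- refutation (verdict clean-up 2026-08-16); REMOVE-WHEN the record is deleted from this file
set_option linter.deprecated false in
/-- **The Coppersmith–Winograd §11 hypothesis is false** (given Naslund–Sawin's Thm. 3): for every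
pair `(G, S)` with the no-three-disjoint-equivoluminous-subsets property and `|G| ≥ 2`,
`log₂|G| ≥ |S|/80000`, so `(log₂|G|)/|S|` does not approach `0`. (The constant is crude; the
true liminf is `≥ log₂((2/3)2^{2/3}) = 0.0817…`.) PROVED from the named fact.
[cite: BlasiakChurchCohnGrochowNaslundSawinUmans2017, §1 (p. 2)] [cite: NaslundSawin2017, Thm. 3] -/
theorem not_cwEquivoluminousHypothesis (hNS : NaslundSawin2017_thm3) :
    ¬ CWEquivoluminousHypothesis := by
  intro hCW
  obtain ⟨G, _, _, _, S, hG, hS, hlt⟩ := hCW (1 / 80000) (by norm_num)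
  set n := S.card with hn
  have hG2 : (2 : ℝ) ≤ Fintype.card G := by exact_mod_cast hG
  have hlogG := hS.log_card_ge hNS hG
  -- `log₂ |G| ≥ log |G|` since `0 < log 2 ≤ 1`
  have hlogb : Real.log (Fintype.card G) ≤ Real.logb 2 (Fintype.card G) := by
    rw [Real.logb]
    refine le_div_self (Real.log_nonneg (by linarith)) (Real.log_pos one_lt_two) ?_
    have := Real.log_two_lt_d9
    linarith
  have hlow : (n : ℝ) / 80000 ≤ Real.log (Fintype.card G) := by
    by_cases hn4 : (40000 : ℝ) ≤ n
    · -- large `n`: `log 3 + log(n+1) ≤ 2 + 2√(n+1) ≤ 2 + n/50`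
      have hlog3 : Real.log 3 ≤ 2 := by
        have := Real.log_le_sub_one_of_pos (show (0 : ℝ) < 3 by norm_num); linarith
      have hsqrt : Real.log ((n : ℝ) + 1) ≤ 2 * Real.sqrt (n + 1) := by
        have h1 := Real.log_le_rpow_div (show (0 : ℝ) ≤ n + 1 by positivity)
          (show (0 : ℝ) < 1 / 2 by norm_num)
        rw [← Real.sqrt_eq_rpow] at h1
        linarith
      have hsq : Real.sqrt ((n : ℝ) + 1) ≤ n / 100 := by
        calc Real.sqrt ((n : ℝ) + 1) ≤ Real.sqrt (((n : ℝ) / 100) ^ 2) :=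
              Real.sqrt_le_sqrt (by nlinarith)
          _ = n / 100 := Real.sqrt_sq (by positivity)
      linarith
    · -- small `n`: `log |G| ≥ log 2 > 1/2 ≥ n/80000`
      push Not at hn4
      have h2 : Real.log 2 ≤ Real.log (Fintype.card G) := Real.log_le_log two_pos hG2
      have := Real.log_two_gt_d9
      linarith
  have : (1 / 80000 : ℝ) * n ≤ Real.logb 2 (Fintype.card G) := by linarith
  exact absurd hlt (not_lt.2 this)

end Barrier

/-! ## Catalogue entry (D-0021) -/

section Catalogue

/-- **Coppersmith–Winograd's §11 program cannot be carried out: pairs `(G,S)` with no three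
disjoint equivoluminous subsets have `log₂|G| ≥ c|S|` (Alon–Shpilka–Umans 2013 + the sunflower
bound of Naslund–Sawin 2017 / the cap-set theorem).** The catalogue entry is the conjunction of the
sunflower bound (named fact) with CW's derivation (named fact); the refutation of CW's hypothesis
is PROVED from the former (`EquivoluminousBarrier.hypothesis_false`).

BARRIER
technique_class: Coppersmith–Winograd 1990 §11 program: prove `ω = 2` by exhibiting abelian groups `G` and subsets `S ⊆ G` with the "no three disjoint equivoluminous subsets" property (`NoThreeDisjointEquivoluminous`) and `(log₂|G|)/|S| → 0` (`CWEquivoluminousHypothesis`), fed into the `x₀y₁z₂ + ⋯` tensor-power / Fourier-cancellation construction of CW §11; more broadly "CW-conjecture"-type combinatorial hypotheses refuted by sunflower / cap-set / slice-rank bounds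
blocks: the route `CWEquivoluminousHypothesis → ω = 2` (`CoppersmithWinograd1990_sec11`: "With the assumption that `ζ = (log₂|G|)/|S|` approaches `0`, this would yield `ω = 2`. We have not been able to determine whether there exist such pairs `(G,S)`") [cite: CoppersmithWinograd1990, §11] is vacuous: NO such sequence exists — every pair has `2^{|S|} ≤ |G| · 3(|S|+1)∑_{k≤|S|/3} binom(|S|,k)` (`NoThreeDisjointEquivoluminous.two_pow_le_card_mul`), hence `log₂|G| ≥ |S|/80000` (`not_cwEquivoluminousHypothesis`, proved from the sunflower bound; unconditional with the rate `log₂|G| ≥ 0.0817·|S| − log₂(3(|S|+1))` in the companion file `EquivoluminousBarrierProofs.lean`: `NaslundSawin2017_thm3_holds`, `not_cwEquivoluminousHypothesis_unconditional`, `NoThreeDisjointEquivoluminous.logb_card_ge_rate`; the hypothesis itself is a retired `@[deprecated]` record), i.e. "the cap set bounds … disprove the Coppersmith–Winograd 'no three disjoint equivoluminous subsets' conjecture, which was proposed as a means to show that `ω = 2`" [cite: BlasiakChurchCohnGrochowNaslundSawinUmans2017, §1 (p. 2)] [cite: NaslundSawin2017, Thm. 3].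
because: if three distinct subsets `A, B, C ⊆ S` with equal sums formed a sunflower with kernel `Y`, the petals `A∖Y, B∖Y, C∖Y` would be pairwise disjoint, not all empty and equivoluminous (`∑(A∖Y) = ∑A − ∑Y`), contradicting the CW property; so each of the `|G|` sum-fibres of the `2^{|S|}` subsets of `S` is sunflower-free (`isSunflowerFree_sumFibre`, proved; the connection is Alon–Shpilka–Umans') [cite: BlasiakChurchCohnGrochowNaslundSawinUmans2017, §1 (p. 2)], and "any sunflower-free family `𝓕` of subsets of `{1,2,…,n}` has size at most `|𝓕| ≤ 3(n+1)∑_{k≤n/3} binom(n,k) ≤ (3/2^{2/3})^{n(1+o(1))}`" by the Croot–Lev–Pach / Ellenberg–Gijswijt polynomial (slice-rank) method [cite: NaslundSawin2017, Thm. 3]; with `∑_{k≤n/3} binom(n,k) ≤ 2^{n/3}(3/2)ⁿ` this gives `|G| ≥ ((2/3)2^{2/3})ⁿ/(3(n+1))`, `n = |S|`.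
evasions_known: none published for this specific program; CW themselves note the characteristic-two Salem–Spencer analogue as a different open direction [cite: CoppersmithWinograd1990, §10 (closing remarks)]; the related "strong USP" conjecture of CKSU 2005 is likewise refuted (BCCGNSU Thm. A via ASU), while CKSU's "two families" conjecture and STPP constructions in abelian groups of unbounded exponent remain open [cite: BlasiakChurchCohnGrochowNaslundSawinUmans2017, §1–2 (pp. 2–5)].
scope_caveats: (a) only the specific hypothesis of CW §11 (pairs with no three disjoint equivoluminous subsets and `log₂|G| = o(|S|)`) is refuted; CW's §11 machinery with other combinatorial inputs, and the Coppersmith–Winograd tensors themselves, are untouched by this entry (for those see `UniversalMethodBarrier.lean`, `IrreversibilityBarrier.lean`, `RectangularBarrier.lean`) [cite: CoppersmithWinograd1990, §11]; (b) `CoppersmithWinograd1990_sec11` (hypothesis ⇒ `ω = 2`) is CW's sketched derivation, vendored as a named fact; since its antecedent is false it carries no information about `ω`; (c) Alon–Shpilka–Umans 2013 is not held in the store: the reduction is proved here directly and ASU is credited through BCCGNSU's sentence, without an ASU theorem number; (d) the rate constant proved in THIS file, `1/80000`, is crude; the rate `log₂((2/3)2^{2/3}) = 0.0817…` is proved in the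 companion file (`NoThreeDisjointEquivoluminous.logb_card_ge_rate`).
status: theorem (established) [cite: NaslundSawin2017, Thm. 3] [cite: BlasiakChurchCohnGrochowNaslundSawinUmans2017, §1 (p. 2)] -/
def EquivoluminousBarrier : Prop :=
  NaslundSawin2017_thm3 ∧ CoppersmithWinograd1990_sec11

/-- Projection: the sunflower bound. [cite: NaslundSawin2017, Thm. 3] -/
theorem EquivoluminousBarrier.sunflower (h : EquivoluminousBarrier) : NaslundSawin2017_thm3 := h.1

/-- Projection: CW's derivation. [cite: CoppersmithWinograd1990, §11] -/
theorem EquivoluminousBarrier.cw (h : EquivoluminousBarrier) : CoppersmithWinograd1990_sec11 := h.2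

-- names the `@[deprecated]` (refuted) record `CWEquivoluminousHypothesis` on purpose: this is its
-- refutation under the catalogue entry (verdict clean-up 2026-08-16); REMOVE-WHEN the record is gone
set_option linter.deprecated false in
/-- Under the barrier, CW's hypothesis is false, so `CoppersmithWinograd1990_sec11` cannot be used
to derive `ω = 2` (unconditionally: `EquivoluminousBarrier_holds.hypothesis_false` =
`not_cwEquivoluminousHypothesis_unconditional` in `EquivoluminousBarrierProofs.lean`).
[cite: NaslundSawin2017, Thm. 3] -/
theorem EquivoluminousBarrier.hypothesis_false (h : EquivoluminousBarrier) :
    ¬ CWEquivoluminousHypothesis :=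
  not_cwEquivoluminousHypothesis h.1

end Catalogue

end Literature.Barriers.MatrixMultiplication
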